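import Literature.NumberTheory.GaloisRepresentations.CyclotomicTowerLocalIndex
import Literature.NumberTheory.GaloisRepresentations.BrauerCyclicLayer
import Literature.NumberTheory.GaloisRepresentations.GlobalArtinMapOfCharactersProofs
import HarnessLib

/-!
# The layer characters `ψ_m : Γ_K ↠ ℤ/p^m` of a `ℤ_p`-extension; the cyclotomic tower is
# unramified outside `p` (Washington §13.1; Serre, *Cohomologie galoisienne* II §4.4)

Let `K` be a number field, `p` a prime and `κ : Γ_K ↠ ℤ_p` a `ℤ_p`-extension (the tree's
`ZpExtension K p`, with layers `K_m = K̄^{κ⁻¹(p^m ℤ_p)}`, `ZpExtension.layer`/`layerSubgroup`).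

* `ZpExtension.exists_cyclicCharacter_layer` — **the layer character** (cf. the tree's
  `Literature.NumberTheory.GaloisCohomology.galFixing_layer`, `CyclotomicKillingPrimePower.lean`): for every `m` there is a
  cyclic character `ψ_m : Γ_K ↠ ℤ/p^m` (the tree's `CyclicCharacter`, i.e. `κ mod p^m`) with
  `ker ψ_m = κ⁻¹(p^m ℤ_p) = Gal(K̄/K_m)` (Washington §13.1: `Gal(K_m/K) ≃ ℤ/p^m`);
* `ZpExtension.isAbelianGalois_layer` — `K_m/K` is (finite) abelian;
* `ZpExtension.IsCyclotomic.absGaloisRestrict_mem_kerSubgroup_of_mem_absInertia` — **the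
  cyclotomic `ℤ_p`-extension is unramified outside `p`**: for a finite place `v ∤ p` the inertia
  group of `Γ_{K_v}` maps into `ker κ` (the `p`-adic cyclotomic character kills the inertia groups
  away from `p`, tree `smul_eq_self_of_mem_inertia_of_pow_prime_pow_eq_one`); hence every layer
  character kills `res_v(I_{K_v})` (`…apply_absGaloisRestrict_eq_zero_of_mem_absInertia`).

These feed the tree's discharge of `poitouTate_sum_localTatePairing_eq_zero` (the classes killed on
`K_m` are cyclic classes `κ_N(b) ∪ ψ_m`, ramified only above `p`).  Theorems only (D-0026).

## References

* L. Washington, *Introduction to Cyclotomic Fields* (1997), §13.1. [Washington1997]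
* J.-P. Serre, *Cohomologie galoisienne* (1997), II §4.4 Lemme 1. [SerreGaloisCohomology1997]
* J.-P. Serre, *Abelian ℓ-adic representations and elliptic curves* (1968), I §1.2. [SerreAbelianLadic1968]
-/

noncomputable section

open Function Field NumberField IsDedekindDomain

namespace Literature.NumberTheory.EllipticCurves.ZpExtension

open Literature.NumberTheory.GaloisRepresentations
open Literature.NumberTheory.GaloisRepresentations.LocalWeilDatum

variable {K : Type} [Field K] [NumberField K] {p : ℕ} [hp : Fact p.Prime] (κ : ZpExtension K p)

/-- **The layer character `ψ_m = κ mod p^m : Γ_K ↠ ℤ/p^m`** of a `ℤ_p`-extension, as a cyclic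
character of the tree with kernel `κ⁻¹(p^m ℤ_p) = Gal(K̄/K_m)` (Washington §13.1:
`Gal(K_m/K) ≃ ℤ_p/p^m ℤ_p`). [cite: Washington1997, §13.1] -/
theorem exists_cyclicCharacter_layer (m : ℕ) :
    ∃ ψ : CyclicCharacter (absoluteGaloisGroup K) (p ^ m),
      ψ.ker = κ.layerSubgroup m ∧ ψ.ker = galFixing K (κ.layer m) ∧
        ∀ σ, ψ σ = PadicInt.toZModPow m (κ σ).toAdd := by
  classical
  -- `κ mod p^m` as a homomorphism to `Multiplicative (ℤ/p^m)`
  let f : absoluteGaloisGroup K →* Multiplicative (ZMod (p ^ m)) :=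
    { toFun := fun σ => Multiplicative.ofAdd (PadicInt.toZModPow m (κ σ).toAdd)
      map_one' := by rw [map_one, toAdd_one, map_zero]; rfl
      map_mul' := fun σ τ => by rw [map_mul, toAdd_mul, map_add]; rfl }
  have hf : ∀ σ, f σ = Multiplicative.ofAdd (PadicInt.toZModPow m (κ σ).toAdd) := fun _ => rfl
  have hker : f.ker = κ.layerSubgroup m := by
    ext σ
    rw [MonoidHom.mem_ker, hf, ← ofAdd_zero, Multiplicative.ofAdd.injective.eq_iff, mem_layerSubgroup,
      ← Ideal.mem_span_singleton, ← PadicInt.ker_toZModPow, RingHom.mem_ker]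
  have hopen : IsOpen (f.ker : Set (absoluteGaloisGroup K)) := by
    rw [hker]; exact κ.isOpen_layerSubgroup m
  have hcont : Continuous f := MonoidHom.continuous_of_isOpen_ker f hopen
  -- surjectivity: the image has `p^m` elements
  have hsurj : Function.Surjective f := by
    have hidx : f.ker.index = p ^ m := by rw [hker, κ.index_layerSubgroup]
    have hcard : Nat.card f.range = Nat.card (Multiplicative (ZMod (p ^ m))) := by
      rw [← Subgroup.index_ker, hidx, Nat.card_eq_fintype_card]
      simp
    have htop : f.range = ⊤ := Subgroup.eq_top_of_card_eq _ hcard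
    exact MonoidHom.range_eq_top.mp htop
  refine ⟨⟨fun σ => Multiplicative.toAdd (f σ), fun σ τ => by rw [map_mul, toAdd_mul],
    continuous_toAdd.comp hcont, fun a => ?_⟩, ?_, ?_, fun σ => rfl⟩
  · obtain ⟨σ, hσ⟩ := hsurj (Multiplicative.ofAdd a)
    exact ⟨σ, by change Multiplicative.toAdd (f σ) = a; rw [hσ, toAdd_ofAdd]⟩
  · ext σ
    rw [CyclicCharacter.mem_ker, ← hker, MonoidHom.mem_ker]
    change Multiplicative.toAdd (f σ) = 0 ↔ f σ = 1
    exact ⟨fun h => by rw [← ofAdd_toAdd (f σ), h, ofAdd_zero], fun h => by rw [h, toAdd_one]⟩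
  · ext σ
    rw [CyclicCharacter.mem_ker, galFixing, Subgroup.mem_comap, fixingSubgroup_layer, ← hker]
    change Multiplicative.toAdd (f σ) = 0 ↔ _
    rw [Subgroup.mem_map]
    constructor
    · intro h
      refine ⟨σ, ?_, rfl⟩
      rw [MonoidHom.mem_ker, ← ofAdd_toAdd (f σ), h, ofAdd_zero]
    · rintro ⟨τ, hτ, hτσ⟩
      have : τ = σ := (absoluteGaloisGroup.toAlgEquiv K).injective hτσ
      subst this
      rw [MonoidHom.mem_ker] at hτ
      rw [hτ, toAdd_one]

/-- **The layers `K_m/K` are abelian** (cyclic of order `p^m`). [cite: Washington1997, §13.1] -/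
theorem isAbelianGalois_layer (m : ℕ) : IsAbelianGalois K (κ.layer m) := by
  haveI : IsGalois K (κ.layer m) := κ.isGalois_layer_holds m
  obtain ⟨ψ, -, hker, -⟩ := κ.exists_cyclicCharacter_layer m
  haveI : IsCyclic (κ.layer m ≃ₐ[K] κ.layer m) := isCyclic_of_cyclicLayer ψ (κ.layer m) hker
  exact { is_comm := ⟨fun a b => IsCyclic.commGroup.mul_comm a b⟩ }

/-- **The cyclotomic `ℤ_p`-extension is unramified outside `p`**: for a finite place `v` with
`p ∉ v` and `σ` in the inertia group of `Γ_{K_v}`, `res_v σ ∈ ker κ` — the `p`-adic cyclotomic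
character is trivial on the inertia group at `v` (it fixes `μ_{p^∞}(K̄)`, tree
`smul_eq_self_of_mem_inertia_of_pow_prime_pow_eq_one` + `cyclotomicCharacter_eq_one_of_forall_pow_eq_one`),
and `ker κ = χ_p⁻¹(μ(ℤ_p)) ⊇ ker χ_p`. [cite: SerreAbelianLadic1968, Ch. I §1.2 (Example: the cyclotomic character)]
[cite: Washington1997, §13.1] -/
theorem IsCyclotomic.absGaloisRestrict_mem_kerSubgroup_of_mem_absInertia {κ : ZpExtension K p}
    (hκ : κ.IsCyclotomic) {v : HeightOneSpectrum (𝓞 K)} (hv : (p : 𝓞 K) ∉ v.asIdeal)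
    {σ : absoluteGaloisGroup (v.adicCompletion K)} (hσ : σ ∈ absInertia (v.adicCompletion K)) :
    absGaloisRestrict K (v.adicCompletion K) σ ∈ κ.kerSubgroup := by
  have hin : absGaloisRestrict K (v.adicCompletion K) σ ∈
      (adicCompletionPrime K v).inertia (absoluteGaloisGroup K) := by
    rw [inertia_adicCompletionPrime_eq_map_absInertia]
    exact ⟨σ, hσ, rfl⟩
  have hχ : GaloisRep.cyclotomicCharacter K p (absGaloisRestrict K (v.adicCompletion K) σ) = 1 := by
    rw [GaloisRep.cyclotomicCharacter_apply]
    refine cyclotomicCharacter_eq_one_of_forall_pow_eq_one p _ fun n t ht => ?_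
    exact smul_eq_self_of_mem_inertia_of_pow_prime_pow_eq_one hv (adicCompletionPrime_mem_primesAbove K v) hin ht
  rw [show κ.kerSubgroup = _ from hκ, Subgroup.mem_comap]
  change GaloisRep.cyclotomicCharacter K p _ ∈ CommGroup.torsion ℤ_[p]ˣ
  rw [hχ]
  exact one_mem _

/-- **The layer characters of the cyclotomic `ℤ_p`-extension kill the inertia groups away from
`p`**: for `v ∤ p`, `σ ∈ I_{K_v}` and any `ψ` with `ker ψ = κ⁻¹(p^m ℤ_p)`, `ψ(res_v σ) = 0`.
[cite: Washington1997, §13.1] -/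
theorem IsCyclotomic.apply_absGaloisRestrict_eq_zero_of_mem_absInertia {κ : ZpExtension K p}
    (hκ : κ.IsCyclotomic) {m : ℕ} {ψ : CyclicCharacter (absoluteGaloisGroup K) (p ^ m)}
    (hker : ψ.ker = κ.layerSubgroup m) {v : HeightOneSpectrum (𝓞 K)} (hv : (p : 𝓞 K) ∉ v.asIdeal)
    {σ : absoluteGaloisGroup (v.adicCompletion K)} (hσ : σ ∈ absInertia (v.adicCompletion K)) :
    ψ (absGaloisRestrict K (v.adicCompletion K) σ) = 0 := by
  rw [← CyclicCharacter.mem_ker, hker]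
  exact κ.kerSubgroup_le_layerSubgroup m (hκ.absGaloisRestrict_mem_kerSubgroup_of_mem_absInertia hv hσ)

end Literature.NumberTheory.EllipticCurves.ZpExtension

end
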